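import Mathlib
import Literature.Probability.LatticeModels.ProdBernoulliIndependence
import Literature.Probability.Percolation.KozmaNitzanPinning
import Literature.Probability.Percolation.ClusterBoundary
import Literature.Probability.Percolation.PercolationProofs
import Summits.CriticalPhenomena.PercolationContinuityZ3.Theorems.PercNearOneGluingNearOneGluingPocketBound
import Summits.CriticalPhenomena.PercolationContinuityZ3.Theorems.PercNearOneGluingNearOneGluingPocketBoundAux
import Summits.CriticalPhenomena.PercolationContinuityZ3.Theorems.PercNearOneGluingNoHeavyLowerTailDepthOneGluingAdm
import HarnessLib
import Summits.CriticalPhenomena.PercolationContinuityZ3.Theorems.PercNearOneGluingNoHeavyLowerTailPocketSelectionBound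

/-!
# Crux `PercNearOneGluing.NoHeavyLowerTail` (stmt-CriticalPhenomena-4575), line `bhk-superadditivity-thinning` —
# the PER-POCKET selection bound, public form (tool for the locality lemma)

Helper file for the crux (lead prover-line-stmt-CriticalPhenomena-4575-c2-0, 2026-08-16); lands with
`--supports stmt-CriticalPhenomena-4575`.

## Content

The landed `pocketSelectionBound` (file `…PocketSelectionBound.lean`, p77174) bounds the gluing
defect `μ(o ↔ A, o ↮ b)` by `Σ_{S₀} μ(pocket = S₀, o ↔ A, sel S₀ ↮ b)` for ONE globally admissible
selection rule `sel`.  Its per-pocket core — for a single pocket value `S₀ ∋ o` disjoint from `A ∋ b`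
and ANY point `a` admissible at `S₀` (at most as reliable towards `b` as every positive-weight relay
neighbour of `S₀`, all pairs touching `S₀` closed),
`μ({o ↔ A, o ↮ b} ∩ {pocket = S₀}) ≤ μ({pocket = S₀} ∩ {o ↔ A, a ↮ b})` —
is `private` there.  This file re-proves it verbatim (the three private lemmas and the term bound are
copied from that file, renamed `pst_*`; proofs unchanged: Kozma–Nitzan arXiv:2401.12397 Thm 4 /
Lemma 5 in the pocket-contracted world via `depthOneGluing_admissible`) and exposes
`pocketSelTermLe`, with the merge data discharged and the trivial case `a ∈ S₀` included, so that
SEVERAL admissible comparison points can be used — and averaged — on the same pocket (the locality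
lemma of the lead, file `…Locality.lean`).  No new definitions.
-/

namespace Summit.CriticalPhenomena.PercolationContinuityZ3.Theorems

open scoped BigOperators Classical
open MeasureTheory Set
open Literature.Probability.LatticeModels (prodBernoulli prodBernoulli_real_inter_of_determinedBy)
open Literature.Probability.Percolation

section PocketSelTerm

variable {n : ℕ} {S₀ A : Finset (Fin n)} {o : Fin n}
  {π : Sym2 (Fin n) → Option (Sym2 (Fin n))} {Φ : Set (Sym2 (Fin n)) → Set (Sym2 (Fin n))}
  {F₀ : Finset (Sym2 (Fin n))} {w w' : Sym2 (Fin n) → unitInterval}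

/-- **The merged weights with the star of `o` closed are the original weights with all pairs
touching `S₀` closed.** A pair avoiding `S₀` is its own fibre (merged weight `w e`) and lies
outside both pinned sets; a pair touching `S₀` is pinned to `0` on the right, and on the left it is
either in the star of `o` (pinned to `0`) or has empty fibre (merged weight `0`). -/
theorem pst_pinW_star_merge_eq {F : Finset (Sym2 (Fin n))}
    (hF : ∀ e, e ∈ F ↔ o ∈ e ∧ ¬ e.IsDiag)
    (hπ1 : ∀ x y, x ∉ S₀ → y ∉ S₀ → π s(x, y) = some s(x, y))
    (hπ3 : ∀ x y k, π s(x, y) = some k → (x ∉ S₀ ∧ y ∉ S₀ ∧ k = s(x, y)) ∨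
      (x ∈ S₀ ∧ y ∈ A ∧ k = s(o, y)) ∨ (y ∈ S₀ ∧ x ∈ A ∧ k = s(o, x)))
    (hw' : ∀ k, (w' k : ℝ) = 1 - ∏ e ∈ Finset.univ.filter (fun e => π e = some k), (1 - (w e : ℝ)))
    (ho : o ∈ S₀) (hoA : o ∉ A) :
    pinW w' (↑F : Set (Sym2 (Fin n))) (∅ : Set (Sym2 (Fin n))) =
      pinW w (edgesTouching (↑S₀ : Set (Fin n))) (∅ : Set (Sym2 (Fin n))) := by
  funext e
  induction e using Sym2.ind with
  | _ p q =>
  by_cases hpq : p ∉ S₀ ∧ q ∉ S₀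
  · -- the pair avoids `S₀`
    have heF : s(p, q) ∉ (↑F : Set (Sym2 (Fin n))) := fun h => by
      obtain ⟨hoe, -⟩ := (hF _).1 (Finset.mem_coe.1 h)
      rcases Sym2.mem_iff.1 hoe with rfl | rfl
      exacts [hpq.1 ho, hpq.2 ho]
    have heT : s(p, q) ∉ edgesTouching (↑S₀ : Set (Fin n)) := by
      rintro ⟨v, hv, hvS⟩
      rcases Sym2.mem_iff.1 hv with rfl | rfl
      exacts [hpq.1 (Finset.mem_coe.1 hvS), hpq.2 (Finset.mem_coe.1 hvS)]
    rw [pinW_apply_of_not_mem w' ∅ heF, pinW_apply_of_not_mem w ∅ heT]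
    have hfil : Finset.univ.filter (fun e => π e = some s(p, q)) = {s(p, q)} := by
      ext e
      simp only [Finset.mem_filter, Finset.mem_univ, true_and, Finset.mem_singleton]
      refine ⟨fun he => ?_, fun he => by rw [he]; exact hπ1 p q hpq.1 hpq.2⟩
      revert he
      induction e using Sym2.ind with
      | _ x y =>
      intro he
      rcases hπ3 x y _ he with ⟨-, -, hk⟩ | ⟨-, -, hk⟩ | ⟨-, -, hk⟩
      · exact hk.symm
      · exfalso
        have hmem : o ∈ s(p, q) := by rw [hk]; exact Sym2.mem_mk_left o y
        rcases Sym2.mem_iff.1 hmem with rfl | rfl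
        exacts [hpq.1 ho, hpq.2 ho]
      · exfalso
        have hmem : o ∈ s(p, q) := by rw [hk]; exact Sym2.mem_mk_left o x
        rcases Sym2.mem_iff.1 hmem with rfl | rfl
        exacts [hpq.1 ho, hpq.2 ho]
    apply Subtype.ext
    rw [hw', hfil, Finset.prod_singleton]
    ring
  · -- the pair touches `S₀`
    have heT : s(p, q) ∈ edgesTouching (↑S₀ : Set (Fin n)) := by
      rw [not_and_or, not_not, not_not] at hpq
      rcases hpq with hp | hq
      exacts [⟨p, Sym2.mem_mk_left p q, Finset.mem_coe.2 hp⟩,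
        ⟨q, Sym2.mem_mk_right p q, Finset.mem_coe.2 hq⟩]
    rw [pinW_apply_of_mem_of_not_mem w heT (Set.notMem_empty _)]
    by_cases heF : s(p, q) ∈ (↑F : Set (Sym2 (Fin n)))
    · exact pinW_apply_of_mem_of_not_mem w' heF (Set.notMem_empty _)
    · rw [pinW_apply_of_not_mem w' ∅ heF]
      have hemp : ∀ e, π e ≠ some s(p, q) := by
        intro e
        induction e using Sym2.ind with
        | _ x y =>
        intro he
        rcases hπ3 x y _ he with ⟨hx, hy, hk⟩ | ⟨-, hy, hk⟩ | ⟨-, hx, hk⟩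
        · apply hpq
          rcases Sym2.eq_iff.1 hk with ⟨rfl, rfl⟩ | ⟨rfl, rfl⟩
          exacts [⟨hx, hy⟩, ⟨hy, hx⟩]
        · apply heF
          rw [Finset.mem_coe, hF, hk]
          exact ⟨Sym2.mem_mk_left o y, fun hd => hoA (by rw [Sym2.mk_isDiag_iff.1 hd]; exact hy)⟩
        · apply heF
          rw [Finset.mem_coe, hF, hk]
          exact ⟨Sym2.mem_mk_left o x, fun hd => hoA (by rw [Sym2.mk_isDiag_iff.1 hd]; exact hx)⟩
      have h := hw' s(p, q)
      rw [Finset.filter_eq_empty_iff.2 (fun e _ => hemp e), Finset.prod_empty, sub_self] at h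
      exact Set.Icc.coe_eq_zero.1 h

/-- **A positive merged weight at `s(o, v)` comes from a positive-weight pair from `S₀` to `v`**
(the fibre of `s(o, v)` consists of the pairs `s(x, v)`, `x ∈ S₀`). -/
theorem pst_exists_weight_ne_zero_of_merge
    (hπ3 : ∀ x y k, π s(x, y) = some k → (x ∉ S₀ ∧ y ∉ S₀ ∧ k = s(x, y)) ∨
      (x ∈ S₀ ∧ y ∈ A ∧ k = s(o, y)) ∨ (y ∈ S₀ ∧ x ∈ A ∧ k = s(o, x)))
    (hw' : ∀ k, (w' k : ℝ) = 1 - ∏ e ∈ Finset.univ.filter (fun e => π e = some k), (1 - (w e : ℝ)))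
    (ho : o ∈ S₀) {v : Fin n} (hne : w' s(o, v) ≠ 0) : ∃ x ∈ S₀, w s(x, v) ≠ 0 := by
  by_contra hall
  push Not at hall
  apply hne
  have hprod : ∏ e ∈ Finset.univ.filter (fun e => π e = some s(o, v)), (1 - (w e : ℝ)) = 1 := by
    refine Finset.prod_eq_one fun e he => ?_
    simp only [Finset.mem_filter, Finset.mem_univ, true_and] at he
    suffices h0 : w e = 0 by rw [h0]; simp
    revert he
    induction e using Sym2.ind with
    | _ x y =>
    intro he
    rcases hπ3 x y _ he with ⟨hx, hy, hk⟩ | ⟨hx, -, hk⟩ | ⟨hy, -, hk⟩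
    · exfalso
      have hmem : o ∈ s(x, y) := by rw [← hk]; exact Sym2.mem_mk_left o v
      rcases Sym2.mem_iff.1 hmem with rfl | rfl
      exacts [hx ho, hy ho]
    · have hyv : y = v := by
        rcases Sym2.eq_iff.1 hk with ⟨-, h⟩ | ⟨h1, h2⟩
        exacts [h.symm, h1.symm.trans h2.symm]
      rw [hyv]
      exact hall x hx
    · have hxv : x = v := by
        rcases Sym2.eq_iff.1 hk with ⟨-, h⟩ | ⟨h1, h2⟩
        exacts [h.symm, h1.symm.trans h2.symm]
      rw [hxv, Sym2.eq_swap]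
      exact hall y hy
  have h := hw' s(o, v)
  rw [hprod, sub_self] at h
  exact Set.Icc.coe_eq_zero.1 h

/-- **Walk lemma (lifting back from the merged world).** If `S₀` is internally `o`-spanned, the
boundary pairs of the pocket are closed, and the merged configuration lies in
`{o ↔ A} ∩ {a ↮ b}` (`a, b ∉ S₀`), then the pocket of `ω` is exactly `S₀` (a path inside `Aᶜ`
from `o` cannot cross the closed boundary), `o ↔ A` in `ω` (the first merged pair `{o, a'}` of an
open path comes from an open `{x, a'}`, `x ∈ S₀`), and `a ↮ b` in `ω` (`merge_mem_openConn`). -/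
theorem pst_mem_pocket_inter_of_merge
    (hΦ' : ∀ ω u v, s(u, v) ∈ Φ ω ↔ (u ∉ S₀ ∧ v ∉ S₀ ∧ s(u, v) ∈ ω) ∨
      (u = o ∧ v ∈ A ∧ ∃ x ∈ S₀, s(x, v) ∈ ω) ∨ (v = o ∧ u ∈ A ∧ ∃ x ∈ S₀, s(x, u) ∈ ω))
    (hF₀ : ∀ x y, s(x, y) ∈ F₀ ↔ (x ∈ S₀ ∧ y ∉ S₀ ∧ y ∉ A) ∨ (y ∈ S₀ ∧ x ∉ S₀ ∧ x ∉ A))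
    (ho : o ∈ S₀) (hSA : Disjoint S₀ A) {a b : Fin n} (ha : a ∉ S₀) (hb : b ∉ S₀)
    {ω : Set (Sym2 (Fin n))} (hspan : ∀ v ∈ S₀, ω ∈ openConnIn (↑S₀ : Set (Fin n)) o v)
    (hcl : ∀ e ∈ F₀, e ∉ ω)
    (hΦω : Φ ω ∈ (⋃ a' ∈ A, openConn o a') ∩ (openConn a b)ᶜ) :
    ω ∈ {ω : Set (Sym2 (Fin n)) | ∀ v : Fin n, ω ∈ openConnIn (↑A : Set (Fin n))ᶜ o v ↔ v ∈ S₀} ∩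
      ((⋃ a' ∈ A, openConn o a') ∩ (openConn a b)ᶜ) := by
  obtain ⟨hU, hab⟩ := hΦω
  have hSU : (↑S₀ : Set (Fin n)) ⊆ (↑A : Set (Fin n))ᶜ := fun v hv hvA =>
    Finset.disjoint_left.1 hSA (Finset.mem_coe.1 hv) (Finset.mem_coe.1 hvA)
  refine ⟨fun v => ⟨fun hv => ?_, fun hv => ?_⟩, ?_,
    fun h => hab (merge_mem_openConn hΦ' hF₀ ho ha hb h hcl)⟩
  · -- a path inside `Aᶜ` from `o` cannot leave `S₀`
    have hp := DCT16.pathIn_of_mem_openConnIn hv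
    rcases hp.exit_or (R := (↑S₀ : Set (Fin n))) (Finset.mem_coe.2 ho) with
      h | ⟨x, y, hx, hy, hyU, hxy, -⟩
    · exact Finset.mem_coe.1 h.right_mem.1
    · exfalso
      rw [openGraph_adj] at hxy
      exact hcl _ ((hF₀ x y).2 (Or.inl ⟨Finset.mem_coe.1 hx, fun h => hy (Finset.mem_coe.2 h),
        fun h => hyU (Finset.mem_coe.2 h)⟩)) hxy.1
  · exact DCT16.mem_openConnIn_of_pathIn ((DCT16.pathIn_of_mem_openConnIn (hspan v hv)).mono hSU)
  · simp only [mem_iUnion, exists_prop] at hU ⊢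
    obtain ⟨a', ha'A, hoa'⟩ := hU
    have ha'o : a' ≠ o := fun h => (Finset.disjoint_left.1 hSA ho) (h ▸ ha'A)
    obtain ⟨p⟩ := hoa'
    cases p with
    | nil => exact absurd rfl ha'o
    | cons hadj _ =>
      obtain ⟨hmem, hne⟩ := (openGraph_adj (Φ ω) _ _).1 hadj
      rcases (hΦ' ω o _).1 hmem with ⟨hoS, -, -⟩ | ⟨-, hzA, x, hx, hxz⟩ | ⟨hzo, -, -⟩
      · exact absurd ho hoS
      · refine ⟨_, hzA, ?_⟩
        refine (openConnIn_subset_openConn _ o x (hspan x hx)).trans (SimpleGraph.Adj.reachable ?_)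
        rw [openGraph_adj]
        exact ⟨hxz, fun h => Finset.disjoint_left.1 hSA hx (h ▸ hzA)⟩
      · exact absurd hzo.symm hne

/-- **The per-pocket selection bound.** For a pocket value `S₀ ∋ o` disjoint from `A ∋ b`, a
comparison point `a ∉ S₀` admissible with respect to the weights with all pairs touching `S₀`
closed, and the merge data `π, Φ, w', F₀` of `S₀`:
`μ({o ↔ A, o ↮ b} ∩ {pocket = S₀}) ≤ μ({pocket = S₀} ∩ {o ↔ A, a ↮ b})`. -/
theorem pst_pocket_sel_term_le (w : Sym2 (Fin n) → unitInterval) {S₀ A : Finset (Fin n)}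
    {o b a : Fin n} (ho : o ∈ S₀) (hSA : Disjoint S₀ A) (hoA : o ∉ A) (hb : b ∈ A) (haS : a ∉ S₀)
    (hadm : ∀ v ∈ A, (∃ x ∈ S₀, w s(x, v) ≠ 0) →
      (prodBernoulli (pinW w (edgesTouching (↑S₀ : Set (Fin n))) (∅ : Set (Sym2 (Fin n))))).real
          (openConn a b) ≤
        (prodBernoulli (pinW w (edgesTouching (↑S₀ : Set (Fin n))) (∅ : Set (Sym2 (Fin n))))).real
          (openConn v b))
    {π : Sym2 (Fin n) → Option (Sym2 (Fin n))} {Φ : Set (Sym2 (Fin n)) → Set (Sym2 (Fin n))}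
    {w' : Sym2 (Fin n) → unitInterval} {F₀ : Finset (Sym2 (Fin n))}
    (hπ1 : ∀ x y, x ∉ S₀ → y ∉ S₀ → π s(x, y) = some s(x, y))
    (hπ2 : ∀ x y, x ∈ S₀ → y ∈ A → π s(x, y) = some s(o, y))
    (hπ3 : ∀ x y k, π s(x, y) = some k → (x ∉ S₀ ∧ y ∉ S₀ ∧ k = s(x, y)) ∨
      (x ∈ S₀ ∧ y ∈ A ∧ k = s(o, y)) ∨ (y ∈ S₀ ∧ x ∈ A ∧ k = s(o, x)))
    (hΦ : ∀ ω k, k ∈ Φ ω ↔ ∃ e ∈ ω, π e = some k)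
    (hw' : ∀ k, (w' k : ℝ) = 1 - ∏ e ∈ Finset.univ.filter (fun e => π e = some k), (1 - (w e : ℝ)))
    (hF₀ : ∀ x y, s(x, y) ∈ F₀ ↔ (x ∈ S₀ ∧ y ∉ S₀ ∧ y ∉ A) ∨ (y ∈ S₀ ∧ x ∉ S₀ ∧ x ∉ A)) :
    (prodBernoulli w).real (((⋃ a' ∈ A, openConn o a') ∩ (openConn o b)ᶜ) ∩
        {ω | ∀ v : Fin n, ω ∈ openConnIn (↑A : Set (Fin n))ᶜ o v ↔ v ∈ S₀}) ≤
      (prodBernoulli w).real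
        ({ω | ∀ v : Fin n, ω ∈ openConnIn (↑A : Set (Fin n))ᶜ o v ↔ v ∈ S₀} ∩
          ((⋃ a' ∈ A, openConn o a') ∩ (openConn a b)ᶜ)) := by
  set μ := prodBernoulli w with hμ
  set Span : Set (Set (Sym2 (Fin n))) := {ω | ∀ v ∈ S₀, ω ∈ openConnIn (↑S₀ : Set (Fin n)) o v}
    with hSpan
  set Cl : Set (Set (Sym2 (Fin n))) := {ω | ∀ e ∈ F₀, e ∉ ω} with hCl
  set Bad : Set (Set (Sym2 (Fin n))) := (⋃ a' ∈ A, openConn o a') ∩ (openConn o b)ᶜ with hBad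
  set Good : Set (Set (Sym2 (Fin n))) := (⋃ a' ∈ A, openConn o a') ∩ (openConn a b)ᶜ with hGood
  set Pock : Set (Set (Sym2 (Fin n))) :=
    {ω | ∀ v : Fin n, ω ∈ openConnIn (↑A : Set (Fin n))ᶜ o v ↔ v ∈ S₀} with hPock
  have hbS : b ∉ S₀ := fun h => Finset.disjoint_left.1 hSA h hb
  have hΦ' := mk_mem_merge_iff hπ1 hπ2 hπ3 hΦ
  have hkey : ∀ Y, μ.real (Φ ⁻¹' Y) = (prodBernoulli w').real Y :=
    prodBernoulli_real_preimage_fiberMap w w' π Φ hΦ hw'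
  have hdetΦ : ∀ Y, DeterminedBy (Φ ⁻¹' Y) (↑(S₀.sym2 ∪ F₀)ᶜ : Set (Sym2 (Fin n))) :=
    determinedBy_preimage_merge hπ3 hΦ hF₀ hSA
  -- pair-set bookkeeping (adapted from `pocket_term_le`)
  have hF₀S : (↑F₀ : Set (Sym2 (Fin n))) ⊆ (↑S₀.sym2 : Set (Sym2 (Fin n)))ᶜ := by
    intro e he heS
    rw [Finset.mem_coe] at he heS
    revert he heS
    induction e using Sym2.ind with
    | _ x y =>
    intro he heS
    rw [Finset.mk_mem_sym2_iff] at heS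
    rcases (hF₀ x y).1 he with ⟨-, hy, -⟩ | ⟨-, hx, -⟩
    exacts [hy heS.2, hx heS.1]
  have hES : (↑(S₀.sym2 ∪ F₀)ᶜ : Set (Sym2 (Fin n))) ⊆ (↑S₀.sym2 : Set (Sym2 (Fin n)))ᶜ := by
    intro e he heS
    rw [Finset.coe_compl, mem_compl_iff, Finset.coe_union, mem_union] at he
    exact he (Or.inl heS)
  have hEF : (↑(S₀.sym2 ∪ F₀)ᶜ : Set (Sym2 (Fin n))) ⊆ (↑F₀ : Set (Sym2 (Fin n)))ᶜ := by
    intro e he heF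
    rw [Finset.coe_compl, mem_compl_iff, Finset.coe_union, mem_union] at he
    exact he (Or.inr heF)
  -- independence of the three factors
  have hI : ∀ Y, μ.real (Span ∩ (Cl ∩ Φ ⁻¹' Y)) =
      μ.real Span * (μ.real Cl * (prodBernoulli w').real Y) := by
    intro Y
    rw [prodBernoulli_real_inter_of_determinedBy w S₀.sym2 (determinedBy_span S₀ o)
      (((determinedBy_forall_notMem F₀).mono hF₀S).inter ((hdetΦ Y).mono hES))
      MeasurableSet.of_discrete MeasurableSet.of_discrete,
      prodBernoulli_real_inter_of_determinedBy w F₀ (determinedBy_forall_notMem F₀)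
      ((hdetΦ Y).mono hEF) MeasurableSet.of_discrete MeasurableSet.of_discrete, hkey]
  -- the merged world: `o` is isolated off `A`, and `a` is admissible there
  have hiso : ∀ x : Fin n, x ∉ A → x ≠ o → w' s(o, x) = 0 := by
    intro x hxA hxo
    have h := hw' s(o, x)
    rw [Finset.filter_eq_empty_iff.2 (fun e _ => merge_ne_some hπ3 ho hxA hxo e),
      Finset.prod_empty, sub_self] at h
    exact Set.Icc.coe_eq_zero.1 h
  have hadm' : ∀ F : Finset (Sym2 (Fin n)), (∀ e, e ∈ F ↔ o ∈ e ∧ ¬ e.IsDiag) →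
      ∀ v ∈ A, w' s(o, v) ≠ 0 →
        (prodBernoulli (pinW w' (↑F : Set (Sym2 (Fin n))) (∅ : Set (Sym2 (Fin n))))).real
            (openConn a b) ≤
          (prodBernoulli (pinW w' (↑F : Set (Sym2 (Fin n))) (∅ : Set (Sym2 (Fin n))))).real
            (openConn v b) := by
    intro F hF v hv hne
    rw [pst_pinW_star_merge_eq hF hπ1 hπ3 hw' ho hoA]
    exact hadm v hv (pst_exists_weight_ne_zero_of_merge hπ3 hw' ho hne)
  have heart : (prodBernoulli w').real Bad ≤ (prodBernoulli w').real Good :=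
    depthOneGluing_admissible n w' A o b a hoA hiso (hadm' _ fun e => by simp)
  -- assemble
  have hsub1 : Bad ∩ Pock ⊆ Span ∩ (Cl ∩ Φ ⁻¹' Bad) := fun ω ⟨hbad, hω⟩ =>
    ⟨fun v hv => mem_openConnIn_of_pocket hω hv, fun e he => notMem_of_pocket hF₀ hω he,
      merge_mem_bad hΦ' hF₀ ho hSA hbad hω⟩
  have hsub2 : Span ∩ (Cl ∩ Φ ⁻¹' Good) ⊆ Pock ∩ Good := fun ω ⟨hsp, hcl, hΦω⟩ =>
    pst_mem_pocket_inter_of_merge hΦ' hF₀ ho hSA haS hbS hsp hcl hΦω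
  calc μ.real (Bad ∩ Pock) ≤ μ.real (Span ∩ (Cl ∩ Φ ⁻¹' Bad)) := measureReal_mono hsub1
    _ = μ.real Span * (μ.real Cl * (prodBernoulli w').real Bad) := hI Bad
    _ ≤ μ.real Span * (μ.real Cl * (prodBernoulli w').real Good) :=
        mul_le_mul_of_nonneg_left (mul_le_mul_of_nonneg_left heart measureReal_nonneg)
          measureReal_nonneg
    _ = μ.real (Span ∩ (Cl ∩ Φ ⁻¹' Good)) := (hI Good).symm
    _ ≤ μ.real (Pock ∩ Good) := measureReal_mono hsub2

end PocketSelTerm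

/-- **The per-pocket selection bound, public form.**  For ONE pocket value `S₀ ∋ o` disjoint from
`A ∋ b` and ANY comparison point `a` admissible at `S₀` (for every relay point `v ∈ A` joined to
`S₀` by a positive-weight pair, `P_{G−S₀}(a ↔ b) ≤ P_{G−S₀}(v ↔ b)`, where `G − S₀` = all pairs
touching `S₀` pinned closed):
`μ({o ↔ A, o ↮ b} ∩ {pocket = S₀}) ≤ μ({pocket = S₀} ∩ {o ↔ A, a ↮ b})`,
`pocket(ω) = {v | ω ∈ openConnIn (↑A)ᶜ o v}`.  If `a ∈ S₀` the bound is trivial (`a ↔ b` would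
force `o ↔ b`); otherwise it is `pst_pocket_sel_term_le` with the merge data of
`…PocketBoundAux.lean` (Kozma–Nitzan arXiv:2401.12397 Thm 4 / Lemma 5 in the contracted world). -/
theorem pocketSelTermLe' (n : ℕ) (w : Sym2 (Fin n) → unitInterval) (A S₀ : Finset (Fin n))
    (o b a : Fin n) (hoS : o ∈ S₀) (hSA : Disjoint S₀ A) (hoA : o ∉ A) (hb : b ∈ A)
    (hadm : ∀ v ∈ A, (∃ x ∈ S₀, w s(x, v) ≠ 0) →
      (prodBernoulli (pinW w (edgesTouching (↑S₀ : Set (Fin n))) (∅ : Set (Sym2 (Fin n))))).real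
          (openConn a b) ≤
        (prodBernoulli (pinW w (edgesTouching (↑S₀ : Set (Fin n))) (∅ : Set (Sym2 (Fin n))))).real
          (openConn v b)) :
    (prodBernoulli w).real (((⋃ a' ∈ A, openConn o a') ∩ (openConn o b)ᶜ) ∩
        {ω | ∀ v : Fin n, ω ∈ openConnIn (↑A : Set (Fin n))ᶜ o v ↔ v ∈ S₀}) ≤
      (prodBernoulli w).real
        ({ω | ∀ v : Fin n, ω ∈ openConnIn (↑A : Set (Fin n))ᶜ o v ↔ v ∈ S₀} ∩
          ((⋃ a' ∈ A, openConn o a') ∩ (openConn a b)ᶜ)) := by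
  by_cases haS : a ∈ S₀
  · -- the comparison point lies in the pocket: `a ↔ b` would force `o ↔ b`
    refine measureReal_mono ?_
    rintro ω ⟨⟨hU, hnb⟩, hω⟩
    refine ⟨hω, hU, fun hab => hnb ?_⟩
    exact (openConnIn_subset_openConn _ o _ (mem_openConnIn_of_pocket hω haS)).trans hab
  · obtain ⟨π, hπ1, hπ2, hπ3⟩ := exists_mergeFiber S₀ A o hSA
    obtain ⟨w', hw'⟩ := exists_fiberWeights w π
    obtain ⟨F₀, hF₀⟩ := exists_boundaryPairs S₀ A
    exact pst_pocket_sel_term_le w hoS hSA hoA hb haS hadm hπ1 hπ2 hπ3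
      (Φ := fun ω => {k | ∃ e ∈ ω, π e = some k}) (fun _ _ => Iff.rfl) hw' hF₀

/-- **Registered sub-goal `pocketSelTermLe` of crux stmt-CriticalPhenomena-4575** (verbatim
signature, fully qualified): the per-pocket selection bound, public form — see
`pocketSelTermLe'`. -/
theorem pocketSelTermLe :
    ∀ (n : ℕ) (w : Sym2 (Fin n) → unitInterval) (A S₀ : Finset (Fin n)) (o b a : Fin n), o ∈ S₀ → Disjoint S₀ A → o ∉ A → b ∈ A → (∀ v ∈ A, (∃ x ∈ S₀, w s(x, v) ≠ 0) → (Literature.Probability.LatticeModels.prodBernoulli (Literature.Probability.Percolation.pinW w (Literature.Probability.Percolation.edgesTouching (↑S₀ : Set (Fin n))) (∅ : Set (Sym2 (Fin n))))).real (Literature.Probability.Percolation.openConn a b) ≤ (Literature.Probability.LatticeModels.prodBernoulli (Literature.Probability.Percolation.pinW w (Literature.Probability.Percolation.edgesTouching (↑S₀ : Set (Fin n))) (∅ : Set (Sym2 (Fin n))))).real (Literature.Probability.Percolation.openConn v b)) → (Literature.Probability.LatticeModels.prodBernoulli w).real (((⋃ a' ∈ A, Literature.Probability.Percolation.openConn o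 a') ∩ (Literature.Probability.Percolation.openConn o b)ᶜ) ∩ {ω | ∀ v : Fin n, ω ∈ Literature.Probability.Percolation.openConnIn (↑A : Set (Fin n))ᶜ o v ↔ v ∈ S₀}) ≤ (Literature.Probability.LatticeModels.prodBernoulli w).real ({ω | ∀ v : Fin n, ω ∈ Literature.Probability.Percolation.openConnIn (↑A : Set (Fin n))ᶜ o v ↔ v ∈ S₀} ∩ ((⋃ a' ∈ A, Literature.Probability.Percolation.openConn o a') ∩ (Literature.Probability.Percolation.openConn a b)ᶜ)) :=
  fun n w A S₀ o b a hoS hSA hoA hb hadm => pocketSelTermLe' n w A S₀ o b a hoS hSA hoA hb hadm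

end Summit.CriticalPhenomena.PercolationContinuityZ3.Theorems
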